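import Summits.PneNP.PneNP.Theorems.ChebyshevTracialDesignVirtualEqualsTightOddSet
import Summits.PneNP.PneNP.Theorems.ChebyshevTracialDesignPerCutPinnedPartners
import HarnessLib

/-!
# Cell pnp-psdrank, route `ChebyshevTracialDesign`: the REWEIGHTED cell value of (PC-ν) plus its S²-WEIGHTED TIGHT MASS is the `ν⊗ν`-signed
# sum of the «value + tight mass» defects of the doubly-pinned sub-rectangles — so (PC-ν) on a cell follows from two-sided
# «virtual = tight» on those sub-rectangles at a precision beating the weighted tight mass (crux `TracialDecayExp20`, stmt-PneNP-19878)

Brick 176 (prover g34; MEMO-37 §4(a) in the kernel). Notation: `x_p = 1[p ∈ U]`, `π_M` the partner map, `C_ν(U,M) = Σ_p ν(p,π_Mp)x_px_{π_Mp}`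
(`= 2·Σ_{e ∈ M, e ⊆ U} ν(e)` for symmetric `ν`), `A × B` a rectangle of odd cuts × perfect matchings, and for a vertex quadruple `(p,p',q,q')` the
DOUBLY-PINNED SUB-RECTANGLE `A_{pp'qq'} × B_{pp'qq'}` (`A_{pp'qq'} = {U ∈ A : p,p',q,q' ∈ U}`, `B_{pp'qq'} = {M ∈ B : π_Mp = p', π_Mq = q'}`).
MEMO-36 §2(f)/brick 172 put the corrected smallest open instance (PC-ν) of the amplitude-one heart in the rectangle form
«`Σ_{A×B} W·C_ν² ≤ ε` for all rectangles». Brick 175/175b proved, for the r = 1 functional, that the design value of a dense spread rectangle is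
MINUS ITS HONEST TIGHT MASS (`|V + Tight| ≤ 16μν/n + tails`, two-sided). This file is the (trivial but load-bearing) bookkeeping that turns
two-sided r = 1 statements on the pinned sub-rectangles into the reweighted statement:
* §1 **`reweighted_eq_sum_pinned`** (any weight `W`): `Σ_{U∈A}Σ_{M∈B} W(U,M)·C_ν(U,M)² = Σ_{p,p',q,q'} ν(p,p')ν(q,q')·Σ_{A_{pp'qq'} × B_{pp'qq'}} W`
  (brick 171's expansion of the square, the indicators absorbed into the families);
* §1 **`reweightedTight_eq_sum_pinned`** (the case `W = 1[cc = 1]`): `Σ_{(U,M) ∈ A×B, cc(U,M)=1} C_ν(U,M)² = Σ_{pp'qq'} νν'·#{tight pairs of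
  A_{pp'qq'} × B_{pp'qq'}}` — the S²-WEIGHTED TIGHT MASS, an honest nonnegative quantity (`reweightedTight_nonneg`);
* §2 **`reweighted_add_tight_eq_sum_pinned_defects`**: hence for every normalisation `Z`,
  `Σ_{A×B} W C_ν² + (Σ_{A×B, tight} C_ν²)/Z = Σ_{pp'qq'} νν'·[Σ_{A'×B'} W + #{tight in A'×B'}/Z]` — the reweighted «value + tight mass» is the SIGNED
  sum of the r = 1 «value + tight mass» DEFECTS of the `n⁴` pinned sub-rectangles;
* §3 **`reweighted_le_of_pinned_defects`**: if every pinned sub-rectangle has `|Σ_{A'×B'} W + #{tight}/Z| ≤ ε(p,p',q,q')` (two-sided virtual = tight,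
  e.g. brick 175b in the reduced instance of the pins) and `|ν| ≤ 1`, then
  `Σ_{A×B} W C_ν² ≤ −(Σ_{A×B, tight} C_ν²)/Z + Σ_{pp'qq'} ε ≤ Σ_{pp'qq'} ε` and `|Σ_{A×B} W C_ν² + (Σ_{tight} C_ν²)/Z| ≤ Σ ε`.
READING (MEMO-37 §4). One-sided r = 1 information on the pinned sub-rectangles is useless here (signs of `νν'`); TWO-sided information is summable,
and brick 175 says the two-sided defect of a spread sub-rectangle is `O(μ'ν'/n)` — the factor `1/n` (the sharp layer ratio, brick 174) is what pays
the entrywise loss `E[S_{|ν|}²]/E[S_ν²] ≍ n/8`. What then decides (PC-ν) on the cell is the comparison of `Σ|νν'|ε ≍ (16/n)Σ μ'ν'` with the honest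
weighted tight mass `(Σ_{tight} C_ν²)/Z` — the weighted tight-mass lower bound (T≥) of MEMO-37 §4(b) (numerically θ₀ ≈ 0.845 on the invariant class,
kit j333763). WHAT THIS FILE DOES NOT DO: bound any defect (that is brick 175/175b, per sub-rectangle, in its reduced instance) or the weighted tight
mass from below ((T≥), OPEN); anything on `TracialDecayExp20` itself, psd rank of P_PM(K_n), or P vs NP.
[cite: Rothvoss2017, §2 (PDF p. 6)] [cite: GriblingDelaatLaurent2019, §5] [cite: Grigoriev2001, Lemma 1.4 (PDF p. 8)]
Stature: support/instrument (kernel lane, no defs, axioms standard; exact bookkeeping). Supports stmt-PneNP-19878.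
-/

set_option linter.dupNamespace false -- `Summit.PneNP.PneNP.…`: summit = sub-problem (D-0017)

noncomputable section

namespace Summit.PneNP.PneNP.Theorems.ChebyshevTracialDesignReweightedVirtualEqualsTight

open Finset Literature.Barriers.PneNP Literature.Combinatorics.Optimization
open Summit.PneNP.PneNP.Theorems.ChebyshevTracialDesignPerCutPinnedPartners (edgeField_containment_sq_eq)

variable {n : ℕ}

/-- Moving one inner `Fintype` sum out of a double `Finset` sum. -/
theorem sum3_comm {α β γ : Type*} [Fintype γ] (s : Finset α) (t : Finset β) (f : α → β → γ → ℝ) :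
    ∑ a ∈ s, ∑ b ∈ t, ∑ c, f a b c = ∑ c, ∑ a ∈ s, ∑ b ∈ t, f a b c := by
  calc ∑ a ∈ s, ∑ b ∈ t, ∑ c, f a b c = ∑ a ∈ s, ∑ c, ∑ b ∈ t, f a b c := sum_congr rfl fun a _ => Finset.sum_comm
    _ = ∑ c, ∑ a ∈ s, ∑ b ∈ t, f a b c := Finset.sum_comm

/-- Moving four inner `Fintype` sums out of a double `Finset` sum. -/
theorem sum6_comm {α β γ : Type*} [Fintype γ] (s : Finset α) (t : Finset β) (f : α → β → γ → γ → γ → γ → ℝ) :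
    ∑ a ∈ s, ∑ b ∈ t, ∑ c₁, ∑ c₂, ∑ c₃, ∑ c₄, f a b c₁ c₂ c₃ c₄ =
      ∑ c₁, ∑ c₂, ∑ c₃, ∑ c₄, ∑ a ∈ s, ∑ b ∈ t, f a b c₁ c₂ c₃ c₄ := by
  rw [sum3_comm s t (fun a b c₁ => ∑ c₂, ∑ c₃, ∑ c₄, f a b c₁ c₂ c₃ c₄)]
  refine sum_congr rfl fun c₁ _ => ?_
  rw [sum3_comm s t (fun a b c₂ => ∑ c₃, ∑ c₄, f a b c₁ c₂ c₃ c₄)]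
  refine sum_congr rfl fun c₂ _ => ?_
  rw [sum3_comm s t (fun a b c₃ => ∑ c₄, f a b c₁ c₂ c₃ c₄)]
  refine sum_congr rfl fun c₃ _ => ?_
  rw [sum3_comm s t (fun a b c₄ => f a b c₁ c₂ c₃ c₄)]

/-- Product of two `{0,1}`-indicators. -/
theorem ind_mul_two (a b : Prop) [Decidable a] [Decidable b] :
    (if a then (1 : ℝ) else 0) * (if b then (1 : ℝ) else 0) = if a ∧ b then (1 : ℝ) else 0 := by
  by_cases ha : a <;> by_cases hb : b <;> simp [ha, hb]

/-- Product of four `{0,1}`-indicators, bracketed as in brick 171. -/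
theorem ind_mul_four (a b c d : Prop) [Decidable a] [Decidable b] [Decidable c] [Decidable d] :
    ((if a then (1 : ℝ) else 0) * (if b then (1 : ℝ) else 0)) * ((if c then (1 : ℝ) else 0) * (if d then (1 : ℝ) else 0)) =
      if a ∧ b ∧ c ∧ d then (1 : ℝ) else 0 := by
  by_cases ha : a <;> by_cases hb : b <;> by_cases hc : c <;> by_cases hd : d <;> simp [ha, hb, hc, hd]

/-! ### §1 The reweighted sum over a rectangle as a signed sum over doubly-pinned sub-rectangles -/

/-- **Expansion of the reweighted rectangle sum over pinned sub-rectangles** (any weight `W`, any `ν`):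
`Σ_{U∈A} Σ_{M∈B} W(U,M)·C_ν(U,M)² = Σ_{p,p',q,q'} ν(p,p')ν(q,q')·Σ_{U ∈ A, p,p',q,q' ∈ U} Σ_{M ∈ B, π_Mp = p', π_Mq = q'} W(U,M)`.
[cite: Rothvoss2017, §2 (PDF p. 6)] -/
theorem reweighted_eq_sum_pinned (W : OddSet n → PMatch n → ℝ) (ν : Fin n → Fin n → ℝ)
    (A : Finset (OddSet n)) (B : Finset (PMatch n)) :
    ∑ U ∈ A, ∑ M ∈ B, W U M *
        (∑ p, ν p (M.2.partner p) * ((if p ∈ U.1 then (1 : ℝ) else 0) * (if M.2.partner p ∈ U.1 then (1 : ℝ) else 0))) ^ 2 =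
      ∑ p, ∑ p', ∑ q, ∑ q', (ν p p' * ν q q') *
        ∑ U ∈ A.filter (fun U => p ∈ U.1 ∧ p' ∈ U.1 ∧ q ∈ U.1 ∧ q' ∈ U.1),
          ∑ M ∈ B.filter (fun M => p' = M.2.partner p ∧ q' = M.2.partner q), W U M := by
  classical
  -- the square, per pair, with `h = 1`
  have hsq : ∀ (U : OddSet n) (M : PMatch n),
      (∑ p, ν p (M.2.partner p) * ((if p ∈ U.1 then (1 : ℝ) else 0) * (if M.2.partner p ∈ U.1 then (1 : ℝ) else 0))) ^ 2 =
      ∑ p, ∑ p', ∑ q, ∑ q', (ν p p' * ν q q') *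
        ((if p ∈ U.1 ∧ p' ∈ U.1 ∧ q ∈ U.1 ∧ q' ∈ U.1 then (1 : ℝ) else 0) *
          (if p' = M.2.partner p ∧ q' = M.2.partner q then (1 : ℝ) else 0)) := by
    intro U M
    have h1 := edgeField_containment_sq_eq M U 1 ν
    simp only [one_mul, one_pow] at h1
    rw [h1]
    refine sum_congr rfl fun p _ => sum_congr rfl fun p' _ => sum_congr rfl fun q _ => sum_congr rfl fun q' _ => ?_
    rw [ind_mul_four, ind_mul_two]
    ring
  -- swap the sums and absorb the indicators into the families
  calc ∑ U ∈ A, ∑ M ∈ B, W U M *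
        (∑ p, ν p (M.2.partner p) * ((if p ∈ U.1 then (1 : ℝ) else 0) * (if M.2.partner p ∈ U.1 then (1 : ℝ) else 0))) ^ 2
      = ∑ U ∈ A, ∑ M ∈ B, ∑ p, ∑ p', ∑ q, ∑ q', (ν p p' * ν q q') *
          (W U M * ((if p ∈ U.1 ∧ p' ∈ U.1 ∧ q ∈ U.1 ∧ q' ∈ U.1 then (1 : ℝ) else 0) *
            (if p' = M.2.partner p ∧ q' = M.2.partner q then (1 : ℝ) else 0))) := by
        refine sum_congr rfl fun U _ => sum_congr rfl fun M _ => ?_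
        rw [hsq U M, mul_sum]
        refine sum_congr rfl fun p _ => ?_
        rw [mul_sum]
        refine sum_congr rfl fun p' _ => ?_
        rw [mul_sum]
        refine sum_congr rfl fun q _ => ?_
        rw [mul_sum]
        exact sum_congr rfl fun q' _ => by ring
    _ = ∑ p, ∑ p', ∑ q, ∑ q', ∑ U ∈ A, ∑ M ∈ B, (ν p p' * ν q q') *
          (W U M * ((if p ∈ U.1 ∧ p' ∈ U.1 ∧ q ∈ U.1 ∧ q' ∈ U.1 then (1 : ℝ) else 0) *
            (if p' = M.2.partner p ∧ q' = M.2.partner q then (1 : ℝ) else 0))) :=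
        sum6_comm A B _
    _ = _ := by
        refine sum_congr rfl fun p _ => sum_congr rfl fun p' _ => sum_congr rfl fun q _ => sum_congr rfl fun q' _ => ?_
        rw [sum_filter, mul_sum]
        refine sum_congr rfl fun U _ => ?_
        by_cases hU : p ∈ U.1 ∧ p' ∈ U.1 ∧ q ∈ U.1 ∧ q' ∈ U.1
        · simp only [if_pos hU]
          rw [sum_filter, mul_sum]
          refine sum_congr rfl fun M _ => ?_
          by_cases hM : p' = M.2.partner p ∧ q' = M.2.partner q
          · simp only [if_pos hM]; ring
          · simp only [if_neg hM]; ring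
        · simp only [if_neg hU, mul_zero, zero_mul]
          exact sum_const_zero

/-- **The S²-weighted tight mass as a signed sum of tight counts of pinned sub-rectangles**: with `W = 1[cc = 1]`,
`Σ_{(U,M) ∈ A×B, cc(U,M)=1} C_ν(U,M)² = Σ_{pp'qq'} ν(p,p')ν(q,q')·#{(U,M) ∈ A_{pp'qq'} × B_{pp'qq'} : cc(U,M) = 1}`.
[cite: Rothvoss2017, §2 (PDF p. 6)] -/
theorem reweightedTight_eq_sum_pinned (ν : Fin n → Fin n → ℝ) (A : Finset (OddSet n)) (B : Finset (PMatch n)) :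
    ∑ U ∈ A, ∑ M ∈ B, (if cc U M = 1 then (1 : ℝ) else 0) *
        (∑ p, ν p (M.2.partner p) * ((if p ∈ U.1 then (1 : ℝ) else 0) * (if M.2.partner p ∈ U.1 then (1 : ℝ) else 0))) ^ 2 =
      ∑ p, ∑ p', ∑ q, ∑ q', (ν p p' * ν q q') *
        (((((A.filter (fun U => p ∈ U.1 ∧ p' ∈ U.1 ∧ q ∈ U.1 ∧ q' ∈ U.1)) ×ˢ
            (B.filter (fun M => p' = M.2.partner p ∧ q' = M.2.partner q))).filter
            fun UM : OddSet n × PMatch n => cc UM.1 UM.2 = 1).card : ℕ) : ℝ) := by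
  classical
  rw [reweighted_eq_sum_pinned (fun U M => if cc U M = 1 then (1 : ℝ) else 0) ν A B]
  refine sum_congr rfl fun p _ => sum_congr rfl fun p' _ => sum_congr rfl fun q _ => sum_congr rfl fun q' _ => ?_
  congr 1
  rw [card_filter, Nat.cast_sum, sum_product]
  push_cast
  rfl

/-- The S²-weighted tight mass is nonnegative. -/
theorem reweightedTight_nonneg (ν : Fin n → Fin n → ℝ) (A : Finset (OddSet n)) (B : Finset (PMatch n)) :
    0 ≤ ∑ U ∈ A, ∑ M ∈ B, (if cc U M = 1 then (1 : ℝ) else 0) *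
        (∑ p, ν p (M.2.partner p) * ((if p ∈ U.1 then (1 : ℝ) else 0) * (if M.2.partner p ∈ U.1 then (1 : ℝ) else 0))) ^ 2 :=
  sum_nonneg fun U _ => sum_nonneg fun M _ => mul_nonneg (by split_ifs <;> norm_num) (sq_nonneg _)

/-! ### §2 «Value + weighted tight mass» is the signed sum of the pinned r = 1 defects -/

/-- **THE REWEIGHTED «VALUE + TIGHT MASS» IS THE `ν⊗ν`-SIGNED SUM OF THE PINNED r = 1 DEFECTS.** For any weight `W`, any `ν`, any rectangle
`A × B` and any normalisation `Z`:
`Σ_{A×B} W·C_ν² + (Σ_{A×B, cc=1} C_ν²)/Z = Σ_{pp'qq'} ν(p,p')ν(q,q')·[Σ_{A_{pp'qq'}×B_{pp'qq'}} W + #{tight pairs of A_{pp'qq'}×B_{pp'qq'}}/Z]`.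
[cite: Rothvoss2017, §2 (PDF p. 6)] [cite: GriblingDelaatLaurent2019, §5] -/
theorem reweighted_add_tight_eq_sum_pinned_defects (W : OddSet n → PMatch n → ℝ) (ν : Fin n → Fin n → ℝ)
    (A : Finset (OddSet n)) (B : Finset (PMatch n)) (Z : ℝ) :
    ∑ U ∈ A, ∑ M ∈ B, W U M *
        (∑ p, ν p (M.2.partner p) * ((if p ∈ U.1 then (1 : ℝ) else 0) * (if M.2.partner p ∈ U.1 then (1 : ℝ) else 0))) ^ 2 +
      (∑ U ∈ A, ∑ M ∈ B, (if cc U M = 1 then (1 : ℝ) else 0) *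
        (∑ p, ν p (M.2.partner p) * ((if p ∈ U.1 then (1 : ℝ) else 0) * (if M.2.partner p ∈ U.1 then (1 : ℝ) else 0))) ^ 2) / Z =
      ∑ p, ∑ p', ∑ q, ∑ q', (ν p p' * ν q q') *
        (∑ U ∈ A.filter (fun U => p ∈ U.1 ∧ p' ∈ U.1 ∧ q ∈ U.1 ∧ q' ∈ U.1),
            ∑ M ∈ B.filter (fun M => p' = M.2.partner p ∧ q' = M.2.partner q), W U M +
          (((((A.filter (fun U => p ∈ U.1 ∧ p' ∈ U.1 ∧ q ∈ U.1 ∧ q' ∈ U.1)) ×ˢ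
              (B.filter (fun M => p' = M.2.partner p ∧ q' = M.2.partner q))).filter
              fun UM : OddSet n × PMatch n => cc UM.1 UM.2 = 1).card : ℕ) : ℝ) / Z) := by
  rw [reweighted_eq_sum_pinned W ν A B, reweightedTight_eq_sum_pinned ν A B]
  simp only [mul_add, sum_add_distrib]
  congr 1
  rw [sum_div]
  refine sum_congr rfl fun p _ => ?_
  rw [sum_div]
  refine sum_congr rfl fun p' _ => ?_
  rw [sum_div]
  refine sum_congr rfl fun q _ => ?_
  rw [sum_div]
  refine sum_congr rfl fun q' _ => ?_
  rw [mul_div_assoc]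

/-! ### §3 (PC-ν) on a cell from two-sided pinned defects -/

/-- **(PC-ν) ON A CELL FROM TWO-SIDED «VIRTUAL = TIGHT» ON ITS PINNED SUB-RECTANGLES.** If `|ν| ≤ 1` and every doubly-pinned sub-rectangle
satisfies the two-sided defect bound `|Σ_{A'×B'} W + #{tight in A'×B'}/Z| ≤ ε(p,p',q,q')`, then
`|Σ_{A×B} W C_ν² + (Σ_{A×B, tight} C_ν²)/Z| ≤ Σ_{pp'qq'} ε(p,p',q,q')`, and consequently (the weighted tight mass being `≥ 0` for `Z > 0`)
`Σ_{A×B} W C_ν² ≤ Σ_{pp'qq'} ε(p,p',q,q')`. [cite: Rothvoss2017, §2 (PDF p. 6)] [cite: GriblingDelaatLaurent2019, §5] -/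
theorem reweighted_le_of_pinned_defects (W : OddSet n → PMatch n → ℝ) (ν : Fin n → Fin n → ℝ) (hν : ∀ p p', |ν p p'| ≤ 1)
    (A : Finset (OddSet n)) (B : Finset (PMatch n)) {Z : ℝ} (hZ : 0 < Z) (ε : Fin n → Fin n → Fin n → Fin n → ℝ)
    (hdef : ∀ p p' q q',
      |∑ U ∈ A.filter (fun U => p ∈ U.1 ∧ p' ∈ U.1 ∧ q ∈ U.1 ∧ q' ∈ U.1),
            ∑ M ∈ B.filter (fun M => p' = M.2.partner p ∧ q' = M.2.partner q), W U M +
          (((((A.filter (fun U => p ∈ U.1 ∧ p' ∈ U.1 ∧ q ∈ U.1 ∧ q' ∈ U.1)) ×ˢ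
              (B.filter (fun M => p' = M.2.partner p ∧ q' = M.2.partner q))).filter
              fun UM : OddSet n × PMatch n => cc UM.1 UM.2 = 1).card : ℕ) : ℝ) / Z| ≤ ε p p' q q') :
    |∑ U ∈ A, ∑ M ∈ B, W U M *
          (∑ p, ν p (M.2.partner p) * ((if p ∈ U.1 then (1 : ℝ) else 0) * (if M.2.partner p ∈ U.1 then (1 : ℝ) else 0))) ^ 2 +
        (∑ U ∈ A, ∑ M ∈ B, (if cc U M = 1 then (1 : ℝ) else 0) *
          (∑ p, ν p (M.2.partner p) * ((if p ∈ U.1 then (1 : ℝ) else 0) * (if M.2.partner p ∈ U.1 then (1 : ℝ) else 0))) ^ 2) / Z| ≤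
      ∑ p, ∑ p', ∑ q, ∑ q', ε p p' q q' ∧
    ∑ U ∈ A, ∑ M ∈ B, W U M *
        (∑ p, ν p (M.2.partner p) * ((if p ∈ U.1 then (1 : ℝ) else 0) * (if M.2.partner p ∈ U.1 then (1 : ℝ) else 0))) ^ 2 ≤
      ∑ p, ∑ p', ∑ q, ∑ q', ε p p' q q' := by
  have habs : |∑ U ∈ A, ∑ M ∈ B, W U M *
          (∑ p, ν p (M.2.partner p) * ((if p ∈ U.1 then (1 : ℝ) else 0) * (if M.2.partner p ∈ U.1 then (1 : ℝ) else 0))) ^ 2 +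
        (∑ U ∈ A, ∑ M ∈ B, (if cc U M = 1 then (1 : ℝ) else 0) *
          (∑ p, ν p (M.2.partner p) * ((if p ∈ U.1 then (1 : ℝ) else 0) * (if M.2.partner p ∈ U.1 then (1 : ℝ) else 0))) ^ 2) / Z| ≤
      ∑ p, ∑ p', ∑ q, ∑ q', ε p p' q q' := by
    rw [reweighted_add_tight_eq_sum_pinned_defects W ν A B Z]
    refine le_trans (abs_sum_le_sum_abs _ _) (sum_le_sum fun p _ => ?_)
    refine le_trans (abs_sum_le_sum_abs _ _) (sum_le_sum fun p' _ => ?_)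
    refine le_trans (abs_sum_le_sum_abs _ _) (sum_le_sum fun q _ => ?_)
    refine le_trans (abs_sum_le_sum_abs _ _) (sum_le_sum fun q' _ => ?_)
    rw [abs_mul]
    have hνb : |ν p p' * ν q q'| ≤ 1 := by
      rw [abs_mul]
      calc |ν p p'| * |ν q q'| ≤ 1 * 1 := mul_le_mul (hν p p') (hν q q') (abs_nonneg _) zero_le_one
        _ = 1 := by ring
    calc |ν p p' * ν q q'| * _ ≤ 1 * ε p p' q q' := mul_le_mul hνb (hdef p p' q q') (abs_nonneg _) zero_le_one
      _ = ε p p' q q' := one_mul _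
  refine ⟨habs, ?_⟩
  have htight := div_nonneg (reweightedTight_nonneg ν A B) hZ.le
  have h1 := (abs_le.1 habs).2
  linarith

end Summit.PneNP.PneNP.Theorems.ChebyshevTracialDesignReweightedVirtualEqualsTight
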